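import Mathlib
import Summits.KontsevichZagierPeriods.Zeta5Search.WedgeDictionaryDiagonalShift
import Summits.KontsevichZagierPeriods.Zeta5Search.WedgeDictionaryFaceRelation
import Summits.KontsevichZagierPeriods.Zeta5Search.WedgeDictionaryCoeffV
import Summits.KontsevichZagierPeriods.Zeta5Search.WedgeDictionaryRankTwo
import HarnessLib

/-!
# ζ(5) search — class `elim`: THE HALF-SHIFT `H₄₅₇` AND SUMMABLE COMBINATIONS AT TWO LEVELS (E-L19a, part 1
# of 2: tools; cell `pub-zeta5`, fam-elim gen 23; used by `Elimination/HalfShiftMeet.lean`)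

HONEST FRAMING: systematic search; no irrationality claim unless certified.

OUR work (Summit side; `families/elim/FAMILY.md` §6 (E-L19a)).  Notation: b-chart points `b = (b₀; b₁, …, b₇)` (`InBox`,
`dOf`), `R_b(t) = numPoly_b(t+1)/((t+1)_{b₀+1})⁶`, canonical coefficients `D(b) = (U, W, V)(b)` (`coeffU/W/V`),
slot steps `bump`, and the Pochhammer part `S_b(x)` of `numPoly_b(x) = (2x + b₀)·S_b(x)` (`slotEval`, `slotPoly`).

1. `hShift` — the half-shift `H = H₄₅₇ : (b₀; b) ↦ (b₀ + 1; b + 1_{{4,5,7}})` (the point `Hc` of gen-1's D2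
   cluster `{c, c + e₇, Hc, DSc}`, memo `pub-zeta5-gen-1/D2-CONNECTION-g15.md` §11), its box bookkeeping
   (`inBox_hShift`, `dOf_hShift : d(Hb) = d(b)`), and the two Pochhammer identities behind the meet:
   `eval_numPoly_hShift_mul : Pc(x)·numPoly_{Hb}(x) = (2x + b₀ + 1)(x + b₀ + 1)⁷·PT(x)·S_b(x)` and
   `slotEval_shift_mul : x⁷·∏_j (x + b₀ + 1 − b_j)·S_b(x + 1) = (x + b₀ + 1)⁷·∏_j (x + b_j)·S_b(x)`
   (`Pc = ∏_{j ∉ T}(x + b₀ + 1 − b_j)`, `PT = ∏_{j ∈ T}(x + b_j)`, `T = {4, 5, 7}`).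
2. `coeff_rel_of_summable_mixed` — the two-level form of `coeff_rel_of_summable` / `coeffV_rel_of_summable4`
   (`WedgeDictionaryFaceAbel/CoeffV.lean`): for two points at level `N + 1` and two at level `N` (numerators padded
   by `(X + N + 1)⁶`, data by `padData`), a polynomial identity `Σ cᵢ·numPolyᵢ = g(X+1)·X⁶ − g·(X + N + 1)⁶` with
   `deg g < 6(N + 1)` gives `Σ cᵢ U(bᵢ) = Σ cᵢ W(bᵢ) = 0` and `Σ cᵢ V(bᵢ) = g(1)/((1)_{N+1})⁶` (uniqueness of
   partial fractions `pf_unique` on the level-`N + 1` grid; Abel summation with `harm_succ`).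
What this is NOT: anything about sizes, denominators, valuations or irrationality; the class verdict is
unchanged (T1 NO / T2 NO / T4 YES).
-/

open Finset Polynomial

namespace Summit.KontsevichZagierPeriods.Zeta5Search.Elimination

open Summit.KontsevichZagierPeriods.Zeta5Search.DualSeries (InBox numPoly eval_numPoly numPoly_update)
open Summit.KontsevichZagierPeriods.Zeta5Search.WedgeDictionary
open Literature.NumberTheory.Transcendental
open Literature.NumberTheory.Transcendental.BallRivoal (pfEval pf_unique poch_pos harm pochPoly eval_pochPoly)

/-! ### The half-shift `H = H₄₅₇` -/

/-- The half-shift `H = H₄₅₇`: `(Hb)₀ = b₀ + 1`, `(Hb)_j = b_j + 1` for `j ∈ {4, 5, 7}`, `(Hb)_j = b_j` otherwise. -/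
def hShift (b : ℕ → ℤ) : ℕ → ℤ := fun j => if j = 0 ∨ j = 4 ∨ j = 5 ∨ j = 7 then b j + 1 else b j

/-- The level goes up by one. -/
@[simp] theorem hShift_zero (b : ℕ → ℤ) : hShift b 0 = b 0 + 1 := by simp [hShift]

/-- Raised slots (as `range 7` indices: slot `j + 1 ∈ {4,5,7}` iff `j ∈ {3,4,6}`). -/
theorem hShift_succ_of_mem (b : ℕ → ℤ) {j : ℕ} (hT : j = 3 ∨ j = 4 ∨ j = 6) : hShift b (j + 1) = b (j + 1) + 1 := by
  rcases hT with rfl | rfl | rfl <;> simp [hShift]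

/-- Unraised slots. -/
theorem hShift_succ_of_not_mem (b : ℕ → ℤ) {j : ℕ} (hT : ¬ (j = 3 ∨ j = 4 ∨ j = 6)) : hShift b (j + 1) = b (j + 1) := by
  have h : ¬ (j + 1 = 0 ∨ j + 1 = 4 ∨ j + 1 = 5 ∨ j + 1 = 7) := by omega
  unfold hShift
  exact if_neg h

/-- The Pochhammer part `S_b(x) = ∏_j (x)_{b_j} (x + b₀ − b_j + 1)_{b_j}` of `numPoly b` at `x`
(so that `numPoly_b(x) = (2x + b₀)·S_b(x)`, `eval_numPoly`). -/
def slotEval (b : ℕ → ℤ) (x : ℚ) : ℚ :=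
  ∏ j ∈ range 7, (BallRivoal.poch x (b (j + 1)).toNat * BallRivoal.poch (x + ((b 0 - b (j + 1) + 1 : ℤ) : ℚ)) (b (j + 1)).toNat)

/-- `numPoly_b(x) = (2x + b₀)·S_b(x)`. -/
theorem eval_numPoly_slotEval (b : ℕ → ℤ) (x : ℚ) : (numPoly b).eval x = (2 * x + b 0) * slotEval b x :=
  eval_numPoly b x

/-- `∏_{j ∉ T} (x + b₀ + 1 − b_j)` (`T = {4,5,7}`). -/
def pcStar (b : ℕ → ℤ) (x : ℚ) : ℚ :=
  (x + b 0 + 1 - b 1) * (x + b 0 + 1 - b 2) * (x + b 0 + 1 - b 3) * (x + b 0 + 1 - b 6)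

/-- `∏_{j ∈ T} (x + b_j)`. -/
def ptStar (b : ℕ → ℤ) (x : ℚ) : ℚ := (x + b 4) * (x + b 5) * (x + b 7)

/-- `∏_j (x + b_j)`. -/
def zAll (b : ℕ → ℤ) (x : ℚ) : ℚ :=
  (x + b 1) * (x + b 2) * (x + b 3) * (x + b 4) * (x + b 5) * (x + b 6) * (x + b 7)

/-- `∏_j (x + b₀ + 1 − b_j)`. -/
def nAll (b : ℕ → ℤ) (x : ℚ) : ℚ :=
  (x + b 0 + 1 - b 1) * (x + b 0 + 1 - b 2) * (x + b 0 + 1 - b 3) * (x + b 0 + 1 - b 4) * (x + b 0 + 1 - b 5) *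
    (x + b 0 + 1 - b 6) * (x + b 0 + 1 - b 7)

/-! ### The half-shift multiplies the numerator: `Pc·numPoly_{Hb}(x) = (2x+b₀+1)(x+b₀+1)⁷·PT·S_b(x)` -/

/-- One slot of the half-shift. -/
theorem hShift_slot (z : ℕ → ℤ) (hz : InBox z) (x : ℚ) {j : ℕ} (hj : j ∈ range 7) :
    BallRivoal.poch x (hShift z (j + 1)).toNat *
          BallRivoal.poch (x + ((hShift z 0 - hShift z (j + 1) + 1 : ℤ) : ℚ)) (hShift z (j + 1)).toNat *
        (if j = 3 ∨ j = 4 ∨ j = 6 then (1 : ℚ) else (x + z 0 + 1 - z (j + 1))) =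
      (x + z 0 + 1) * (if j = 3 ∨ j = 4 ∨ j = 6 then (x + z (j + 1)) else (1 : ℚ)) *
        (BallRivoal.poch x (z (j + 1)).toNat * BallRivoal.poch (x + ((z 0 - z (j + 1) + 1 : ℤ) : ℚ)) (z (j + 1)).toNat) := by
  have hzj : 0 ≤ z (j + 1) := (hz.2 j hj).1
  have hcast : (((z (j + 1)).toNat : ℕ) : ℚ) = (z (j + 1) : ℚ) := by exact_mod_cast Int.toNat_of_nonneg hzj
  by_cases hT : j = 3 ∨ j = 4 ∨ j = 6
  · rw [if_pos hT, if_pos hT, hShift_succ_of_mem z hT, hShift_zero]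
    have hn : (z (j + 1) + 1).toNat = (z (j + 1)).toNat + 1 := by omega
    have harg : x + ((z 0 + 1 - (z (j + 1) + 1) + 1 : ℤ) : ℚ) = x + ((z 0 - z (j + 1) + 1 : ℤ) : ℚ) := by
      push_cast; ring
    rw [hn, poch_succ_right, poch_succ_right, harg, hcast]
    push_cast
    ring
  · rw [if_neg hT, if_neg hT, hShift_succ_of_not_mem z hT, hShift_zero]
    have key := slot_shift_N x ((z 0 : ℚ) + 1) (z (j + 1) : ℚ) (z (j + 1)).toNat hcast
    have e1 : x + ((z 0 + 1 - z (j + 1) + 1 : ℤ) : ℚ) = x + (((z 0 : ℚ) + 1) - (z (j + 1) : ℚ) + 1) := by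
      push_cast; ring
    have e2 : x + ((z 0 - z (j + 1) + 1 : ℤ) : ℚ) = x + (((z 0 : ℚ) + 1) - (z (j + 1) : ℚ)) := by push_cast; ring
    rw [e1, e2]
    linear_combination key

/-- **Numerator of the half-shift.** `Pc(x)·numPoly_{Hz}(x) = (2x + z₀ + 1)(x + z₀ + 1)⁷·PT(x)·S_z(x)`. -/
theorem eval_numPoly_hShift_mul (z : ℕ → ℤ) (hz : InBox z) (x : ℚ) :
    (numPoly (hShift z)).eval x * pcStar z x =
      (2 * x + z 0 + 1) * (x + z 0 + 1) ^ 7 * ptStar z x * slotEval z x := by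
  have hprod := prod_congr rfl (fun j hj => hShift_slot z hz x hj)
  simp only [prod_mul_distrib, prod_const, card_range, hShift_zero] at hprod
  have hf : (∏ j ∈ range 7, (if j = 3 ∨ j = 4 ∨ j = 6 then (1 : ℚ) else (x + z 0 + 1 - z (j + 1)))) = pcStar z x := by
    simp only [prod_range_succ, prod_range_zero]
    norm_num [pcStar]
  have hw : (∏ j ∈ range 7, (if j = 3 ∨ j = 4 ∨ j = 6 then (x + z (j + 1) : ℚ) else 1)) = ptStar z x := by
    simp only [prod_range_succ, prod_range_zero]
    norm_num [ptStar]
  rw [hf, hw] at hprod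
  rw [eval_numPoly_slotEval]
  unfold slotEval
  simp only [prod_mul_distrib, hShift_zero]
  push_cast at hprod ⊢
  linear_combination (2 * x + (z 0 : ℚ) + 1) * hprod

/-! ### The integer shift of the Pochhammer part: `x⁷·∏_j(x+z₀+1−z_j)·S_z(x+1) = (x+z₀+1)⁷·∏_j(x+z_j)·S_z(x)` -/

/-- One slot of the shift. -/
theorem shift_slot (z : ℕ → ℤ) (hz : InBox z) (x : ℚ) {j : ℕ} (hj : j ∈ range 7) :
    x * (x + z 0 + 1 - z (j + 1)) *
        (BallRivoal.poch (x + 1) (z (j + 1)).toNat *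
          BallRivoal.poch (x + 1 + ((z 0 - z (j + 1) + 1 : ℤ) : ℚ)) (z (j + 1)).toNat) =
      (x + z 0 + 1) * (x + z (j + 1)) *
        (BallRivoal.poch x (z (j + 1)).toNat * BallRivoal.poch (x + ((z 0 - z (j + 1) + 1 : ℤ) : ℚ)) (z (j + 1)).toNat) := by
  have hzj : 0 ≤ z (j + 1) := (hz.2 j hj).1
  have hcast : (((z (j + 1)).toNat : ℕ) : ℚ) = (z (j + 1) : ℚ) := by exact_mod_cast Int.toNat_of_nonneg hzj
  have z1 := slot_shift_zero x ((z 0 : ℚ) + 1) (z (j + 1) : ℚ) (z (j + 1)).toNat hcast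
  have n1 := slot_shift_N x ((z 0 : ℚ) + 1) (z (j + 1) : ℚ) (z (j + 1)).toNat hcast
  have e1 : x + 1 + ((z 0 - z (j + 1) + 1 : ℤ) : ℚ) = x + 1 + (((z 0 : ℚ) + 1) - (z (j + 1) : ℚ)) := by push_cast; ring
  have e2 : x + ((z 0 - z (j + 1) + 1 : ℤ) : ℚ) = x + (((z 0 : ℚ) + 1) - (z (j + 1) : ℚ)) := by push_cast; ring
  rw [e1, e2]
  linear_combination -(x + (z 0 : ℚ) + 1 - z (j + 1)) * z1 + (x + (z (j + 1) : ℚ)) * n1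

/-- **The shift of the Pochhammer part.** -/
theorem slotEval_shift_mul (z : ℕ → ℤ) (hz : InBox z) (x : ℚ) :
    x ^ 7 * nAll z x * slotEval z (x + 1) = (x + z 0 + 1) ^ 7 * zAll z x * slotEval z x := by
  have hprod := prod_congr rfl (fun j hj => shift_slot z hz x hj)
  simp only [prod_mul_distrib, prod_const, card_range] at hprod
  have hn : (∏ j ∈ range 7, (x + z 0 + 1 - z (j + 1) : ℚ)) = nAll z x := by
    simp only [prod_range_succ, prod_range_zero]; norm_num [nAll]
  have hw : (∏ j ∈ range 7, (x + z (j + 1) : ℚ)) = zAll z x := by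
    simp only [prod_range_succ, prod_range_zero]; norm_num [zAll]
  rw [hn, hw] at hprod
  unfold slotEval
  simp only [prod_mul_distrib]
  linear_combination hprod

/-! ### Summable combinations at two adjacent levels -/

/-- Padding a level-`N` fraction to the level-`N+1` denominator. -/
theorem pad_frac (a P u : ℚ) (hu : u ≠ 0) : a / P ^ 6 = a * u ^ 6 / (P * u) ^ 6 := by
  rw [mul_pow, mul_div_mul_right _ _ (pow_ne_zero 6 hu)]

/-- **Coefficient relations of a summable combination at two adjacent levels** (the mixed-level form of
`coeff_rel_of_summable` / `coeffV_rel_of_summable4`).  Points `b₀, b₁` at level `N + 1` and `b₂, b₃` at level `N`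
(in the box, admissible slot sums); the level-`N` numerators are padded by `(X + N + 1)⁶`.  If
`c₀·numPoly b₀ + c₁·numPoly b₁ + (c₂·numPoly b₂ + c₃·numPoly b₃)·(X+N+1)⁶ = g(X+1)X⁶ − g·(X+N+1)⁶` with `deg g < 6(N+1)`,
then `Σ cᵢ U(bᵢ) = Σ cᵢ W(bᵢ) = 0` and `Σ cᵢ V(bᵢ) = g(1)/((1)_{N+1})⁶`. -/
theorem coeff_rel_of_summable_mixed (b₀ b₁ b₂ b₃ : ℕ → ℤ) (N : ℕ)
    (h₀ : InBox b₀) (h₁ : InBox b₁) (h₂ : InBox b₂) (h₃ : InBox b₃)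
    (hs₀ : ∑ j ∈ range 7, b₀ (j + 1) ≤ 3 * b₀ 0 + 1) (hs₁ : ∑ j ∈ range 7, b₁ (j + 1) ≤ 3 * b₁ 0 + 1)
    (hs₂ : ∑ j ∈ range 7, b₂ (j + 1) ≤ 3 * b₂ 0 + 1) (hs₃ : ∑ j ∈ range 7, b₃ (j + 1) ≤ 3 * b₃ 0 + 1)
    (hN₀ : (b₀ 0).toNat = N + 1) (hN₁ : (b₁ 0).toNat = N + 1) (hN₂ : (b₂ 0).toNat = N) (hN₃ : (b₃ 0).toNat = N)
    (c₀ c₁ c₂ c₃ : ℚ) (g : ℚ[X]) (hg : g.natDegree + 1 ≤ 6 * (N + 1))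
    (hrel : C c₀ * numPoly b₀ + C c₁ * numPoly b₁ + C c₂ * (numPoly b₂ * (X + C ((N + 1 : ℕ) : ℚ)) ^ 6) +
        C c₃ * (numPoly b₃ * (X + C ((N + 1 : ℕ) : ℚ)) ^ 6) =
      g.comp (X + C 1) * X ^ 6 - g * (X + C ((N + 1 : ℕ) : ℚ)) ^ 6) :
    (c₀ * coeffU b₀ + c₁ * coeffU b₁ + c₂ * coeffU b₂ + c₃ * coeffU b₃ = 0 ∧
      c₀ * coeffW b₀ + c₁ * coeffW b₁ + c₂ * coeffW b₂ + c₃ * coeffW b₃ = 0) ∧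
      c₀ * coeffV b₀ + c₁ * coeffV b₁ + c₂ * coeffV b₂ + c₃ * coeffV b₃ =
        g.eval 1 / BallRivoal.poch 1 (N + 1) ^ 6 := by
  obtain ⟨d₀, hd₀⟩ := exists_isPFData b₀ h₀ hs₀
  obtain ⟨d₁, hd₁⟩ := exists_isPFData b₁ h₁ hs₁
  obtain ⟨d₂, hd₂⟩ := exists_isPFData b₂ h₂ hs₂
  obtain ⟨d₃, hd₃⟩ := exists_isPFData b₃ h₃ hs₃
  obtain ⟨γ, hγ⟩ := exists_pf_summable (N := N + 1) (by omega) hg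
  have hγ' : ∀ t : ℚ, (∀ p, p ≤ N → t + p + 1 ≠ 0) →
      pfEval N 6 γ t = (g.comp (X + C 1)).eval t / BallRivoal.poch (t + 1) (N + 1) ^ 6 := by
    intro t ht
    have h := hγ t (by simpa using ht)
    simpa using h
  set e : ℕ → ℕ → ℚ := fun o p =>
    c₀ * d₀ o p + c₁ * d₁ o p + c₂ * padData N d₂ o p + c₃ * padData N d₃ o p + padData N γ o p - shiftUp γ o p
    with he
  -- (1) the corrected data evaluate to zero at every natural point
  have he0 : ∀ t : ℕ, pfEval (N + 1) 6 e t = 0 := by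
    intro t
    have hu : (t : ℚ) + 1 + ((N + 1 : ℕ) : ℚ) ≠ 0 := by positivity
    have E0 := hd₀ t (fun p _ => by positivity)
    have E1 := hd₁ t (fun p _ => by positivity)
    have E2 := hd₂ t (fun p _ => by positivity)
    have E3 := hd₃ t (fun p _ => by positivity)
    rw [hN₀, poch_succ_right] at E0
    rw [hN₁, poch_succ_right] at E1
    rw [hN₂] at E2
    rw [hN₃] at E3
    have E2' := (pfEval_padData (Nat.le_add_right N 1) 6 d₂ (t : ℚ)).trans (E2.trans (pad_frac _ _ _ hu))
    have E3' := (pfEval_padData (Nat.le_add_right N 1) 6 d₃ (t : ℚ)).trans (E3.trans (pad_frac _ _ _ hu))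
    have Esh : pfEval (N + 1) 6 (shiftUp γ) t = pfEval N 6 γ ((t : ℚ) + 1) := pfEval_shiftUp N 6 γ t
    have Epad : pfEval (N + 1) 6 (padData N γ) t = pfEval N 6 γ t := pfEval_padData (Nat.le_add_right N 1) _ _ _
    have Etel := telescope_eval (N := N + 1) (by omega) hrel hγ t
    rw [poch_succ_right] at Etel
    simp only [Nat.add_sub_cancel] at Etel
    rw [he, pfEval_comb4V, E0, E1, E2', E3', Esh, Epad]
    simp only [eval_comp, eval_add, eval_mul, eval_pow, eval_C, eval_X] at Etel ⊢
    linear_combination Etel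
  -- (2) `e` vanishes identically (uniqueness of partial fractions)
  have hpt : ∀ o p, o < 6 → p ≤ N + 1 → e o p = 0 := pf_unique (N + 1) 6 e 0 (fun t _ => he0 t)
  -- (3) order-`o` coefficient sums
  have hsum : ∀ {o : ℕ}, o < 6 →
      c₀ * ∑ p ∈ range (N + 2), d₀ o p + c₁ * ∑ p ∈ range (N + 2), d₁ o p +
        c₂ * ∑ p ∈ range (N + 1), d₂ o p + c₃ * ∑ p ∈ range (N + 1), d₃ o p = 0 := by
    intro o ho
    have hz : ∑ p ∈ range (N + 2), e o p = 0 :=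
      sum_eq_zero fun p hp => hpt o p ho (by have := mem_range.1 hp; omega)
    have htel : ∑ p ∈ range (N + 2), (padData N γ o p - shiftUp γ o p) = 0 := by
      rw [sum_sub_distrib, sum_shiftUp, sum_padData (Nat.le_add_right N 1), sub_self]
    have hp2 : ∑ p ∈ range (N + 2), padData N d₂ o p = ∑ p ∈ range (N + 1), d₂ o p := sum_padData (Nat.le_add_right N 1) _ _
    have hp3 : ∑ p ∈ range (N + 2), padData N d₃ o p = ∑ p ∈ range (N + 1), d₃ o p := sum_padData (Nat.le_add_right N 1) _ _
    have hexp : ∑ p ∈ range (N + 2), e o p =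
        c₀ * ∑ p ∈ range (N + 2), d₀ o p + c₁ * ∑ p ∈ range (N + 2), d₁ o p +
          c₂ * ∑ p ∈ range (N + 2), padData N d₂ o p + c₃ * ∑ p ∈ range (N + 2), padData N d₃ o p +
          ∑ p ∈ range (N + 2), (padData N γ o p - shiftUp γ o p) := by
      simp only [he, sum_add_distrib, sum_sub_distrib, mul_sum]
      ring
    rw [hexp, htel, hp2, hp3, add_zero] at hz
    exact hz
  refine ⟨⟨?_, ?_⟩, ?_⟩
  · have h := hsum (show 4 < 6 by norm_num)
    rw [coeffU_eq hd₀, coeffU_eq hd₁, coeffU_eq hd₂, coeffU_eq hd₃, hN₀, hN₁, hN₂, hN₃]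
    exact h
  · have h := hsum (show 2 < 6 by norm_num)
    rw [coeffW_eq hd₀, coeffW_eq hd₁, coeffW_eq hd₂, coeffW_eq hd₃, hN₀, hN₁, hN₂, hN₃]
    exact h
  -- (4) the constant terms: Abel summation leaves the boundary term `G(0) = g(1)/((1)_{N+1})⁶`
  have hV : c₀ * coeffV b₀ + c₁ * coeffV b₁ + c₂ * coeffV b₂ + c₃ * coeffV b₃ =
      ∑ o ∈ range 6, ∑ p ∈ range (N + 2), (shiftUp γ o p - padData N γ o p) * harm (o + 1) p := by
    rw [coeffV_eq hd₀, coeffV_eq hd₁, coeffV_eq hd₂, coeffV_eq hd₃, hN₀, hN₁, hN₂, hN₃]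
    have hp2 : ∀ o, ∑ p ∈ range (N + 1), d₂ o p * harm (o + 1) p =
        ∑ p ∈ range (N + 2), padData N d₂ o p * harm (o + 1) p := fun o => (sum_padData_mul N d₂ o _).symm
    have hp3 : ∀ o, ∑ p ∈ range (N + 1), d₃ o p * harm (o + 1) p =
        ∑ p ∈ range (N + 2), padData N d₃ o p * harm (o + 1) p := fun o => (sum_padData_mul N d₃ o _).symm
    simp only [hp2, hp3, mul_sum, ← sum_add_distrib]
    refine sum_congr rfl fun o ho => sum_congr rfl fun p hp => ?_
    have h0 := hpt o p (mem_range.1 ho) (by have := mem_range.1 hp; omega)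
    simp only [he] at h0
    linear_combination (harm (o + 1) p) * h0
  have hrow : ∀ o, ∑ p ∈ range (N + 2), (shiftUp γ o p - padData N γ o p) * harm (o + 1) p =
      ∑ p ∈ range (N + 1), γ o p * (1 / ((p : ℚ) + 1) ^ (o + 1)) := by
    intro o
    simp only [sub_mul, sum_sub_distrib]
    rw [sum_shiftUp_mul, sum_padData_mul, ← sum_sub_distrib]
    refine sum_congr rfl fun p _ => ?_
    rw [SymRay.harm_succ]
    ring
  have hpf : pfEval N 6 γ 0 = ∑ o ∈ range 6, ∑ p ∈ range (N + 1), γ o p * (1 / ((p : ℚ) + 1) ^ (o + 1)) := by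
    unfold pfEval
    rw [sum_comm]
    refine sum_congr rfl fun o _ => sum_congr rfl fun p _ => ?_
    ring
  have hγ0 := hγ' 0 (fun p _ => by positivity)
  simp only [eval_comp, eval_add, eval_X, eval_C, zero_add] at hγ0
  rw [hV, sum_congr rfl fun o _ => hrow o, ← hpf, hγ0]

/-! ### The Pochhammer part as a polynomial -/

/-- The Pochhammer part of `numPoly` as a polynomial. -/
noncomputable def slotPoly (b : ℕ → ℤ) : ℚ[X] :=
  ∏ j ∈ range 7, (pochPoly 0 (b (j + 1)).toNat * pochPoly ((b 0 - b (j + 1) + 1 : ℤ) : ℚ) (b (j + 1)).toNat)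

/-- `numPoly b = (2X + b₀)·slotPoly b` (definitionally). -/
theorem numPoly_eq_slotPoly (b : ℕ → ℤ) : numPoly b = (C 2 * X + C (b 0 : ℚ)) * slotPoly b := rfl

/-- `slotPoly` evaluates to `slotEval`. -/
theorem eval_slotPoly (b : ℕ → ℤ) (x : ℚ) : (slotPoly b).eval x = slotEval b x := by
  unfold slotPoly slotEval
  rw [eval_prod]
  refine prod_congr rfl fun j _ => ?_
  rw [eval_mul, eval_pochPoly, eval_pochPoly, add_zero]

/-- `deg slotPoly_b ≤ 2 Σ_j b_j`. -/
theorem natDegree_slotPoly_le (b : ℕ → ℤ) : (slotPoly b).natDegree ≤ ∑ j ∈ range 7, 2 * (b (j + 1)).toNat := by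
  unfold slotPoly
  refine (natDegree_prod_le _ _).trans (sum_le_sum fun j _ => ?_)
  refine natDegree_mul_le.trans ?_
  have e1 := DualSeries.natDegree_pochPoly_le 0 (b (j + 1)).toNat
  have e2 := DualSeries.natDegree_pochPoly_le ((b 0 - b (j + 1) + 1 : ℤ) : ℚ) (b (j + 1)).toNat
  omega

/-! ### Box bookkeeping for the half-shift -/

/-- Slot `7` goes up by one. -/
@[simp] theorem hShift_seven (b : ℕ → ℤ) : hShift b 7 = b 7 + 1 := by simp [hShift]

/-- The half-shift keeps the box. -/
theorem inBox_hShift (z : ℕ → ℤ) (hz : InBox z) : InBox (hShift z) := by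
  refine ⟨by rw [hShift_zero]; linarith [hz.1], fun j hj => ?_⟩
  have h := hz.2 j hj
  rw [hShift_zero]
  by_cases hT : j = 3 ∨ j = 4 ∨ j = 6
  · rw [hShift_succ_of_mem z hT]; constructor <;> linarith [h.1, h.2]
  · rw [hShift_succ_of_not_mem z hT]; constructor <;> linarith [h.1, h.2]

/-- The slot sum goes up by three. -/
theorem sum_hShift (z : ℕ → ℤ) : ∑ j ∈ range 7, hShift z (j + 1) = ∑ j ∈ range 7, z (j + 1) + 3 := by
  simp [sum_range_succ, hShift]
  ring

/-- `d(Hb) = d(b)`. -/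
theorem dOf_hShift (z : ℕ → ℤ) : dOf (hShift z) = dOf z := by
  unfold dOf
  rw [sum_hShift, hShift_zero]
  ring

end Summit.KontsevichZagierPeriods.Zeta5Search.Elimination
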